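import Summits.Ventures.LatticeQCDFlow.Exactness.IMHColdStartMSELimit
import HarnessLib

/-!
# The second-order constant of the cold start is attained at a geometric rate:
# `|N²(MSE_{x₀}(N) − MSE_π(N)) − ((2w² − w)δ² − wσ²_f)| ≤ max(δ², V)·(2Nw + 2w² − w)·r^N`

HONEST FRAMING: exact (Metropolis-corrected) sampling algorithms for lattice gauge theory;
figures of merit are autocorrelation/cost numbers at stated couplings and volumes; no
continuum-physics claim.

Venture `LatticeQCDFlow` (cell pub-lqcd), topic `Exactness`; FANOUT row 30 (lean-1, GEN-33).  NEW WORK of the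
cell, general state space.  GEN-32 (`IMHColdStartMSE`, `IMHColdStartMSELimit`) proved, for flow-MCMC `indepMH q w`
started at a mode `x₀` of the normalised weight (`w = w(x₀)`, `r = 1 − 1/w`, `δ = f(x₀) − π f`, `γ_u` the equilibrium
autocovariances, `V = γ_0`, `σ²_f = γ_0 + 2Σ_{u≥1}γ_u`):
`N²(MSE_{x₀}(N) − MSE_π(N)) = δ²P_N − Q_N`, `P_N = Σ_{k<N}(2k+1)r^k`, `Q_N = Σ_{k<N} r^k Σ_{u<N−k} c_u` (`c_0 = γ_0`,
`c_u = 2γ_u`), and the LIMIT `(2w² − w)δ² − wσ²_f` ("NOT CLAIMED: a rate for the `o(1/N²)`").  Here is the rate —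
geometric, with explicit constants:

* §1 series bookkeeping: **`oddPowSum_eq_limit_sub`** — `P_N = (2w² − w) − r^N(2Nw + 2w² − w)` EXACTLY (finite
  identity, induction); **`tsum_shift_le_geometric`** — a tail `Σ_{u≥m} c_u ≤ 2V r^m w` for weights `c_u ≤ 2V r^u`
  (`u ≥ 1`); **`geomWeightedTail_eq`** / **`geomWeightedTail_bounds`** —
  `wΣc − Q_N = Σ_{k<N} r^k Σ_{u≥N−k} c_u + r^N w Σc ∈ [0, V r^N(2Nw + 2w² − w)]`.
* §2 **`imh_chain_mse_mode_rate`** — for every `N ≥ 1`: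
  `−δ²(2Nw + 2w² − w)r^N ≤ N²(MSE_{x₀}(N) − MSE_π(N)) − ((2w² − w)δ² − wσ²_f) ≤ V(2Nw + 2w² − w)r^N`, hence
  (**`imh_chain_mse_mode_rate_abs`**) `|…| ≤ max(δ², V)·(2Nw + 2w² − w)·r^N`: THE SECOND-ORDER CONSTANT OF THE COLD START
  IS ATTAINED AT THE GEOMETRIC RATE `N r^N` — after `N ≫ w log w` steps the cold-started mean-square error is
  `MSE_π(N) + ((2w² − w)δ² − wσ²_f)/N²` to exponentially small relative error.

Reading (gauge files): with `w = 1/A`, `r = 1 − A` for both exact gauge samplers.  NOT CLAIMED: the sign of the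
deviation for a particular observable beyond the two one-sided bounds; non-modal starts.

No `sorry`, no new definitions, nothing cited as a fact; general measurable space with measurable singletons.
-/

noncomputable section

namespace Summit.Ventures.LatticeQCDFlow.Exactness

open MeasureTheory ProbabilityTheory Function Finset Filter
open scoped ENNReal Topology
open Summit.Ventures.LatticeQCDFlow.Scoring

variable {Ω : Type*} [MeasurableSpace Ω] [MeasurableSingletonClass Ω]
variable {q : Measure Ω} [IsProbabilityMeasure q] {w : Ω → ℝ}

/-! ## §1 Series bookkeeping -/

omit [MeasurableSingletonClass Ω] [IsProbabilityMeasure q] in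
/-- **`Σ_{k<N}(2k+1)(1−a)^k = (2/a² − 1/a) − (1−a)^N·(2N/a + 2/a² − 1/a)`** for `a ≠ 0` (with `a = 1/w`, `r = 1 − a`:
`P_N = (2w² − w) − r^N(2Nw + 2w² − w)`). [ours, algebra] -/
theorem oddPowSum_eq_limit_sub {a : ℝ} (ha : a ≠ 0) : ∀ N : ℕ,
    ∑ k ∈ range N, (2 * (k : ℝ) + 1) * (1 - a) ^ k =
      (2 * a⁻¹ ^ 2 - a⁻¹) - (1 - a) ^ N * (2 * N * a⁻¹ + 2 * a⁻¹ ^ 2 - a⁻¹)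
  | 0 => by simp
  | N + 1 => by
    rw [sum_range_succ, oddPowSum_eq_limit_sub ha N, pow_succ]
    push_cast
    field_simp
    ring

omit [MeasurableSingletonClass Ω] [IsProbabilityMeasure q] in
/-- **A geometric tail**: if `c_u ≤ 2V r^u` for `u ≥ 1` and `c` is summable (`0 ≤ r < 1`), then for `m ≥ 1`
`Σ_{u≥0} c_{u+m} ≤ 2V r^m (1 − r)⁻¹`. [ours, calculus] -/
theorem tsum_shift_le_geometric {r V : ℝ} (hr0 : 0 ≤ r) (hr1 : r < 1) {c : ℕ → ℝ} (hc : Summable c)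
    (hle : ∀ u, 1 ≤ u → c u ≤ 2 * V * r ^ u) {m : ℕ} (hm : 1 ≤ m) :
    ∑' u, c (u + m) ≤ 2 * V * r ^ m * (1 - r)⁻¹ := by
  have hgeo : HasSum (fun u : ℕ => 2 * V * r ^ m * r ^ u) (2 * V * r ^ m * (1 - r)⁻¹) :=
    (hasSum_geometric_of_lt_one hr0 hr1).mul_left (2 * V * r ^ m)
  refine (Summable.tsum_le_tsum (fun u => ?_) ((summable_nat_add_iff m).2 hc) hgeo.summable).trans_eq hgeo.tsum_eq
  calc c (u + m) ≤ 2 * V * r ^ (u + m) := hle _ (le_add_left hm)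
    _ = 2 * V * r ^ m * r ^ u := by rw [pow_add]; ring

omit [MeasurableSingletonClass Ω] [IsProbabilityMeasure q] in
/-- **The remainder of the doubly geometric sum**: for summable `c` and `0 ≤ r < 1`,
`(1 − r)⁻¹Σc − Σ_{k<N} r^k Σ_{u<N−k} c_u = Σ_{k<N} r^k Σ_{u≥0} c_{u+(N−k)} + r^N (1 − r)⁻¹ Σc`. [ours, calculus] -/
theorem geomWeightedTail_eq {r : ℝ} (hr0 : 0 ≤ r) (hr1 : r < 1) {c : ℕ → ℝ} (hc : Summable c) (N : ℕ) :
    (1 - r)⁻¹ * ∑' u, c u - ∑ k ∈ range N, r ^ k * ∑ u ∈ range (N - k), c u =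
      ∑ k ∈ range N, r ^ k * ∑' u, c (u + (N - k)) + r ^ N * (1 - r)⁻¹ * ∑' u, c u := by
  have hgs : Summable fun k : ℕ => r ^ k := summable_geometric_of_lt_one hr0 hr1
  have hgeomtail : ∑' k : ℕ, r ^ (k + N) = r ^ N * (1 - r)⁻¹ := by
    simp_rw [pow_add]
    rw [tsum_mul_right, tsum_geometric_of_lt_one hr0 hr1, mul_comm]
  have hsplit : ∑ k ∈ range N, r ^ k + r ^ N * (1 - r)⁻¹ = (1 - r)⁻¹ := by
    rw [← hgeomtail, Summable.sum_add_tsum_nat_add N hgs, tsum_geometric_of_lt_one hr0 hr1]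
  have htail : ∀ k ∈ range N, ∑' u, c u = ∑ u ∈ range (N - k), c u + ∑' u, c (u + (N - k)) := fun k _ =>
    (Summable.sum_add_tsum_nat_add (N - k) hc).symm
  calc (1 - r)⁻¹ * ∑' u, c u - ∑ k ∈ range N, r ^ k * ∑ u ∈ range (N - k), c u
      = (∑ k ∈ range N, r ^ k + r ^ N * (1 - r)⁻¹) * ∑' u, c u -
          ∑ k ∈ range N, r ^ k * ∑ u ∈ range (N - k), c u := by rw [hsplit]
    _ = ∑ k ∈ range N, (r ^ k * ∑' u, c u - r ^ k * ∑ u ∈ range (N - k), c u) +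
          r ^ N * (1 - r)⁻¹ * ∑' u, c u := by
        rw [sum_sub_distrib, add_mul, sum_mul]
        ring
    _ = ∑ k ∈ range N, r ^ k * ∑' u, c (u + (N - k)) + r ^ N * (1 - r)⁻¹ * ∑' u, c u := by
        congr 1
        refine sum_congr rfl fun k hk => ?_
        rw [htail k hk]
        ring

omit [MeasurableSingletonClass Ω] [IsProbabilityMeasure q] in
/-- **Bounds on the remainder**: `0 ≤ c`, `c_u ≤ 2V r^u` (`u ≥ 1`), `Σc ≤ (1 + r)(1 − r)⁻¹ V` ⇒
`0 ≤ (1 − r)⁻¹Σc − Q_N ≤ V r^N (2N(1 − r)⁻¹ + (1 + r)(1 − r)⁻²)`. [ours, calculus] -/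
theorem geomWeightedTail_bounds {r V : ℝ} (hr0 : 0 ≤ r) (hr1 : r < 1) {c : ℕ → ℝ} (hc : Summable c)
    (hc0 : ∀ u, 0 ≤ c u) (hle : ∀ u, 1 ≤ u → c u ≤ 2 * V * r ^ u) (hsum : ∑' u, c u ≤ (1 + r) * (1 - r)⁻¹ * V)
    (N : ℕ) :
    0 ≤ (1 - r)⁻¹ * ∑' u, c u - ∑ k ∈ range N, r ^ k * ∑ u ∈ range (N - k), c u ∧
    (1 - r)⁻¹ * ∑' u, c u - ∑ k ∈ range N, r ^ k * ∑ u ∈ range (N - k), c u ≤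
      V * r ^ N * (2 * N * (1 - r)⁻¹ + (1 + r) * (1 - r)⁻¹ ^ 2) := by
  have h1r : 0 < (1 - r)⁻¹ := inv_pos.2 (sub_pos.2 hr1)
  have hsc0 : 0 ≤ ∑' u, c u := tsum_nonneg hc0
  rw [geomWeightedTail_eq hr0 hr1 hc N]
  constructor
  · refine add_nonneg (sum_nonneg fun k _ => mul_nonneg (pow_nonneg hr0 k) (tsum_nonneg fun u => hc0 _)) ?_
    exact mul_nonneg (mul_nonneg (pow_nonneg hr0 N) h1r.le) hsc0
  · -- each tail is at most `2V r^{N−k}(1−r)⁻¹`, and `r^k r^{N−k} = r^N`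
    have hterm : ∀ k ∈ range N, r ^ k * ∑' u, c (u + (N - k)) ≤ 2 * V * r ^ N * (1 - r)⁻¹ := by
      intro k hk
      have hk' : k ≤ N := (mem_range.1 hk).le
      have hNk : 1 ≤ N - k := Nat.one_le_iff_ne_zero.2 (Nat.sub_ne_zero_of_lt (mem_range.1 hk))
      calc r ^ k * ∑' u, c (u + (N - k)) ≤ r ^ k * (2 * V * r ^ (N - k) * (1 - r)⁻¹) :=
            mul_le_mul_of_nonneg_left (tsum_shift_le_geometric hr0 hr1 hc hle hNk) (pow_nonneg hr0 k)
        _ = 2 * V * (r ^ k * r ^ (N - k)) * (1 - r)⁻¹ := by ring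
        _ = 2 * V * r ^ N * (1 - r)⁻¹ := by rw [← pow_add, Nat.add_sub_cancel' hk']
    have hS : ∑ k ∈ range N, r ^ k * ∑' u, c (u + (N - k)) ≤ N * (2 * V * r ^ N * (1 - r)⁻¹) := by
      have h := sum_le_sum hterm
      rwa [sum_const, card_range, nsmul_eq_mul] at h
    have hT : r ^ N * (1 - r)⁻¹ * ∑' u, c u ≤ r ^ N * (1 - r)⁻¹ * ((1 + r) * (1 - r)⁻¹ * V) :=
      mul_le_mul_of_nonneg_left hsum (mul_nonneg (pow_nonneg hr0 N) h1r.le)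
    calc _ ≤ N * (2 * V * r ^ N * (1 - r)⁻¹) + r ^ N * (1 - r)⁻¹ * ((1 + r) * (1 - r)⁻¹ * V) := add_le_add hS hT
      _ = V * r ^ N * (2 * N * (1 - r)⁻¹ + (1 + r) * (1 - r)⁻¹ ^ 2) := by ring

/-! ## §2 The rate -/

/-- **THE SECOND-ORDER CONSTANT IS ATTAINED AT A GEOMETRIC RATE.**  `w` measurable (a `Fact`), positive, normalised,
maximal at `x₀`; `f` bounded measurable; `N ≥ 1`; `w = w(x₀)`, `r = 1 − 1/w`, `δ = f(x₀) − π f`,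
`γ_u = autocov K π (f − π f) u`, `V = ∫ (f − π f)² dπ`.  Then
`−δ²(2Nw + 2w² − w)r^N ≤ N²(MSE_{x₀}(N) − MSE_π(N)) − ((2w² − w)δ² − w(γ_0 + 2Σ_{u≥1}γ_u)) ≤ V(2Nw + 2w² − w)r^N`. [ours] -/
theorem imh_chain_mse_mode_rate [Fact (Measurable w)] (hw0 : ∀ y, 0 < w y) {x₀ : Ω}
    (hmax : ∀ y, w y ≤ w x₀) [IsProbabilityMeasure (q.withDensity fun y => ENNReal.ofReal (w y))]
    {f : Ω → ℝ} (hf : Measurable f) {C : ℝ} (hC : ∀ x, |f x| ≤ C) {N : ℕ} (hN : N ≠ 0) :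
    -((f x₀ - ∫ z, f z ∂(q.withDensity fun y => ENNReal.ofReal (w y))) ^ 2 *
        (2 * N * w x₀ + 2 * w x₀ ^ 2 - w x₀) * (1 - (w x₀)⁻¹) ^ N) ≤
      (N : ℝ) ^ 2 *
          (∫ x, ((∑ i ∈ Finset.range N, f (x i)) / N - ∫ z, f z ∂(q.withDensity fun y => ENNReal.ofReal (w y))) ^ 2
              ∂(Kernel.trajMeasure (X := fun _ : ℕ => Ω) (Measure.dirac x₀)
                (fun n : ℕ => (indepMH q w).comap (fun h : (i : ↥(Finset.Iic n)) → Ω => h ⟨n, Finset.mem_Iic.2 le_rfl⟩)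
                  (measurable_pi_apply _))) -
            ∫ x, ((∑ i ∈ Finset.range N, f (x i)) / N - ∫ z, f z ∂(q.withDensity fun y => ENNReal.ofReal (w y))) ^ 2
              ∂(Kernel.trajMeasure (X := fun _ : ℕ => Ω) (q.withDensity fun y => ENNReal.ofReal (w y))
                (fun n : ℕ => (indepMH q w).comap (fun h : (i : ↥(Finset.Iic n)) → Ω => h ⟨n, Finset.mem_Iic.2 le_rfl⟩)
                  (measurable_pi_apply _)))) -
        ((2 * w x₀ ^ 2 - w x₀) * (f x₀ - ∫ z, f z ∂(q.withDensity fun y => ENNReal.ofReal (w y))) ^ 2 -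
          w x₀ * (autocov (indepMH q w) (q.withDensity fun y => ENNReal.ofReal (w y))
              (fun x => f x - ∫ z, f z ∂(q.withDensity fun y => ENNReal.ofReal (w y))) 0 +
            2 * ∑' u, autocov (indepMH q w) (q.withDensity fun y => ENNReal.ofReal (w y))
              (fun x => f x - ∫ z, f z ∂(q.withDensity fun y => ENNReal.ofReal (w y))) (u + 1))) ∧
    (N : ℝ) ^ 2 *
          (∫ x, ((∑ i ∈ Finset.range N, f (x i)) / N - ∫ z, f z ∂(q.withDensity fun y => ENNReal.ofReal (w y))) ^ 2
              ∂(Kernel.trajMeasure (X := fun _ : ℕ => Ω) (Measure.dirac x₀)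
                (fun n : ℕ => (indepMH q w).comap (fun h : (i : ↥(Finset.Iic n)) → Ω => h ⟨n, Finset.mem_Iic.2 le_rfl⟩)
                  (measurable_pi_apply _))) -
            ∫ x, ((∑ i ∈ Finset.range N, f (x i)) / N - ∫ z, f z ∂(q.withDensity fun y => ENNReal.ofReal (w y))) ^ 2
              ∂(Kernel.trajMeasure (X := fun _ : ℕ => Ω) (q.withDensity fun y => ENNReal.ofReal (w y))
                (fun n : ℕ => (indepMH q w).comap (fun h : (i : ↥(Finset.Iic n)) → Ω => h ⟨n, Finset.mem_Iic.2 le_rfl⟩)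
                  (measurable_pi_apply _)))) -
        ((2 * w x₀ ^ 2 - w x₀) * (f x₀ - ∫ z, f z ∂(q.withDensity fun y => ENNReal.ofReal (w y))) ^ 2 -
          w x₀ * (autocov (indepMH q w) (q.withDensity fun y => ENNReal.ofReal (w y))
              (fun x => f x - ∫ z, f z ∂(q.withDensity fun y => ENNReal.ofReal (w y))) 0 +
            2 * ∑' u, autocov (indepMH q w) (q.withDensity fun y => ENNReal.ofReal (w y))
              (fun x => f x - ∫ z, f z ∂(q.withDensity fun y => ENNReal.ofReal (w y))) (u + 1))) ≤
      (∫ x, (f x - ∫ z, f z ∂(q.withDensity fun y => ENNReal.ofReal (w y))) ^ 2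
          ∂(q.withDensity fun y => ENNReal.ofReal (w y))) *
        (2 * N * w x₀ + 2 * w x₀ ^ 2 - w x₀) * (1 - (w x₀)⁻¹) ^ N := by
  have hw : Measurable w := Fact.out
  have hWpos : 0 < w x₀ := hw0 x₀
  have hW : 1 ≤ w x₀ := one_le_of_mode (q := q) hmax
  have ha : (w x₀)⁻¹ ≠ 0 := inv_ne_zero hWpos.ne'
  have hr0 : 0 ≤ 1 - (w x₀)⁻¹ := sub_nonneg.2 (inv_le_one_of_one_le₀ hW)
  have hr1 : 1 - (w x₀)⁻¹ < 1 := sub_lt_self _ (inv_pos.2 hWpos)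
  have h1r : (1 - (1 - (w x₀)⁻¹))⁻¹ = w x₀ := by rw [sub_sub_cancel, inv_inv]
  -- the exact identity of GEN-32 and the closed forms
  have hid := imh_chain_mse_mode_sub_stationary (q := q) hw0 hmax hf hC hN (x₀ := x₀)
  rw [sum_sum_pow_min_eq] at hid
  have hP := oddPowSum_eq_limit_sub ha N
  rw [inv_inv] at hP
  have hγb : ∀ u, 0 ≤ autocov (indepMH q w) (q.withDensity fun y => ENNReal.ofReal (w y))
        (fun x => f x - ∫ z, f z ∂(q.withDensity fun y => ENNReal.ofReal (w y))) u ∧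
      autocov (indepMH q w) (q.withDensity fun y => ENNReal.ofReal (w y))
        (fun x => f x - ∫ z, f z ∂(q.withDensity fun y => ENNReal.ofReal (w y))) u ≤
        (1 - (w x₀)⁻¹) ^ u * ∫ x, (f x - ∫ z, f z ∂(q.withDensity fun y => ENNReal.ofReal (w y))) ^ 2
          ∂(q.withDensity fun y => ENNReal.ofReal (w y)) := fun u =>
    imh_autocov_centred_bounds (q := q) hw hw0 hmax hf hC u
  obtain ⟨hc0, hcs, hcsum, hGK⟩ := autocovWeights_facts hr0 hr1 (fun u => (hγb u).1) (fun u => (hγb u).2)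
  have hle : ∀ u, 1 ≤ u →
      (if u = 0 then autocov (indepMH q w) (q.withDensity fun y => ENNReal.ofReal (w y))
          (fun x => f x - ∫ z, f z ∂(q.withDensity fun y => ENNReal.ofReal (w y))) 0
        else 2 * autocov (indepMH q w) (q.withDensity fun y => ENNReal.ofReal (w y))
          (fun x => f x - ∫ z, f z ∂(q.withDensity fun y => ENNReal.ofReal (w y))) u) ≤
      2 * (∫ x, (f x - ∫ z, f z ∂(q.withDensity fun y => ENNReal.ofReal (w y))) ^ 2
          ∂(q.withDensity fun y => ENNReal.ofReal (w y))) * (1 - (w x₀)⁻¹) ^ u := by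
    intro u hu
    rw [if_neg (by omega)]
    nlinarith [(hγb u).2]
  have hsum' := hGK
  rw [← hcsum, div_eq_mul_inv] at hsum'
  obtain ⟨hQ0, hQ1⟩ := geomWeightedTail_bounds hr0 hr1 hcs hc0 hle hsum' N
  rw [h1r] at hQ0 hQ1
  -- `(1 + r) w² = 2w² − w`
  have hwr : (1 + (1 - (w x₀)⁻¹)) * w x₀ ^ 2 = 2 * w x₀ ^ 2 - w x₀ := by
    field_simp
    ring
  rw [hwr] at hQ1
  have hB0 : 0 ≤ 2 * N * w x₀ + 2 * w x₀ ^ 2 - w x₀ := by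
    have : 0 ≤ (N : ℝ) := Nat.cast_nonneg N
    nlinarith
  have hT0 : 0 ≤ (f x₀ - ∫ z, f z ∂(q.withDensity fun y => ENNReal.ofReal (w y))) ^ 2 *
      ((2 * N * w x₀ + 2 * w x₀ ^ 2 - w x₀) * (1 - (w x₀)⁻¹) ^ N) :=
    mul_nonneg (sq_nonneg _) (mul_nonneg hB0 (pow_nonneg hr0 N))
  rw [hid, hP, ← hcsum]
  constructor
  · linarith
  · linarith

/-- **Absolute form**: `|N²(MSE_{x₀}(N) − MSE_π(N)) − ((2w² − w)δ² − wσ²_f)| ≤ max(δ², V)·(2Nw + 2w² − w)·r^N`. [ours] -/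
theorem imh_chain_mse_mode_rate_abs [Fact (Measurable w)] (hw0 : ∀ y, 0 < w y) {x₀ : Ω}
    (hmax : ∀ y, w y ≤ w x₀) [IsProbabilityMeasure (q.withDensity fun y => ENNReal.ofReal (w y))]
    {f : Ω → ℝ} (hf : Measurable f) {C : ℝ} (hC : ∀ x, |f x| ≤ C) {N : ℕ} (hN : N ≠ 0) :
    |(N : ℝ) ^ 2 *
          (∫ x, ((∑ i ∈ Finset.range N, f (x i)) / N - ∫ z, f z ∂(q.withDensity fun y => ENNReal.ofReal (w y))) ^ 2
              ∂(Kernel.trajMeasure (X := fun _ : ℕ => Ω) (Measure.dirac x₀)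
                (fun n : ℕ => (indepMH q w).comap (fun h : (i : ↥(Finset.Iic n)) → Ω => h ⟨n, Finset.mem_Iic.2 le_rfl⟩)
                  (measurable_pi_apply _))) -
            ∫ x, ((∑ i ∈ Finset.range N, f (x i)) / N - ∫ z, f z ∂(q.withDensity fun y => ENNReal.ofReal (w y))) ^ 2
              ∂(Kernel.trajMeasure (X := fun _ : ℕ => Ω) (q.withDensity fun y => ENNReal.ofReal (w y))
                (fun n : ℕ => (indepMH q w).comap (fun h : (i : ↥(Finset.Iic n)) → Ω => h ⟨n, Finset.mem_Iic.2 le_rfl⟩)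
                  (measurable_pi_apply _)))) -
        ((2 * w x₀ ^ 2 - w x₀) * (f x₀ - ∫ z, f z ∂(q.withDensity fun y => ENNReal.ofReal (w y))) ^ 2 -
          w x₀ * (autocov (indepMH q w) (q.withDensity fun y => ENNReal.ofReal (w y))
              (fun x => f x - ∫ z, f z ∂(q.withDensity fun y => ENNReal.ofReal (w y))) 0 +
            2 * ∑' u, autocov (indepMH q w) (q.withDensity fun y => ENNReal.ofReal (w y))
              (fun x => f x - ∫ z, f z ∂(q.withDensity fun y => ENNReal.ofReal (w y))) (u + 1)))| ≤
      max ((f x₀ - ∫ z, f z ∂(q.withDensity fun y => ENNReal.ofReal (w y))) ^ 2)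
          (∫ x, (f x - ∫ z, f z ∂(q.withDensity fun y => ENNReal.ofReal (w y))) ^ 2
            ∂(q.withDensity fun y => ENNReal.ofReal (w y))) *
        (2 * N * w x₀ + 2 * w x₀ ^ 2 - w x₀) * (1 - (w x₀)⁻¹) ^ N := by
  obtain ⟨hlo, hhi⟩ := imh_chain_mse_mode_rate (q := q) hw0 hmax hf hC hN (x₀ := x₀)
  have hW : 1 ≤ w x₀ := one_le_of_mode (q := q) hmax
  have hr0 : 0 ≤ 1 - (w x₀)⁻¹ := sub_nonneg.2 (inv_le_one_of_one_le₀ hW)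
  have hB0 : 0 ≤ (2 * N * w x₀ + 2 * w x₀ ^ 2 - w x₀) * (1 - (w x₀)⁻¹) ^ N := by
    refine mul_nonneg ?_ (pow_nonneg hr0 N)
    have : 0 ≤ (N : ℝ) := Nat.cast_nonneg N
    nlinarith
  rw [abs_le, mul_assoc]
  constructor
  · have h := mul_le_mul_of_nonneg_right (le_max_left ((f x₀ - ∫ z, f z ∂(q.withDensity fun y =>
      ENNReal.ofReal (w y))) ^ 2) (∫ x, (f x - ∫ z, f z ∂(q.withDensity fun y => ENNReal.ofReal (w y))) ^ 2
        ∂(q.withDensity fun y => ENNReal.ofReal (w y)))) hB0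
    linarith
  · have h := mul_le_mul_of_nonneg_right (le_max_right ((f x₀ - ∫ z, f z ∂(q.withDensity fun y =>
      ENNReal.ofReal (w y))) ^ 2) (∫ x, (f x - ∫ z, f z ∂(q.withDensity fun y => ENNReal.ofReal (w y))) ^ 2
        ∂(q.withDensity fun y => ENNReal.ofReal (w y)))) hB0
    linarith

end Summit.Ventures.LatticeQCDFlow.Exactness
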